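import Summits.ResolutionOfSingularities.ResolutionOfSingularities.Theorems.FrobeniusLadderFInjectiveMacaulayficationE8ChartYPoints
import HarnessLib

/-!
# The `X₀`-chart of the second step of the characteristic-3 tower over `E₈⁰` satisfies the clause

Support file for crux stmt-ResolutionOfSingularities-15315
(`FrobeniusLadder.FInjectiveMacaulayfication`, line `Sketch`, seat c5): stub `stub_e7ChartX0Points`
of the CALIBRATION of the crux's blow-up engine — the second step of the characteristic-`3` tower of
point blow-ups over the rational double point `E₈⁰`. The first step produces the `E₇⁰`-type point
`k[X]/(X₂² + X₁X₀³ + X₁³)` (`E8ChartYPoints`), which still violates the clause in characteristic `3`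
(`E8ChartYOriginNotClauseChar3`); blowing it up at the origin, the `X₀`-chart is the hypersurface
`S/(h₀)`, `S = k[X₀, X₁, X₂]`, `h₀ = X₂² + X₁X₀² + X₀X₁³`, with exceptional divisor `X₀ = 0`.

We prove (`stub_e7ChartX0Points`) that for a field `k` of characteristic `3` and EVERY maximal ideal
`Q` of `S/(h₀)` on the exceptional divisor (`X̄₀ ∈ Q`) the local ring `(S/(h₀))_Q` satisfies the
per-stalk clause of the crux: every system of parameters is a weakly regular sequence and generates a
Frobenius closed ideal (Cohen–Macaulay + F-injective, inline form, `p = 3`).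

Proof. Put `P = Q ∩ S` (a prime containing `X₀` and `h₀`).
* If `X₁ ∈ P` (`clause_of_comap_eq_origin`), then `X₂² = h₀ - X₀(X₁X₀ + X₁³) ∈ P`, so `X₂ ∈ P` and
  `P = (X₀, X₁, X₂)` is the origin (`E8ChartYPoints.eq_span_range_X_of_mem`) — a `D`-type point.
  Fedder's test at the origin (`Fedder.fedder_criterion_origin`, [Fedder1983] Prop. 1.7 / Thm. 1.12)
  reduces the clause for `S_P/(h₀)` to `h₀^(3-1) = h₀² ∉ (X₀³, X₁³, X₂³)`, and this holds
  (`h0_sq_notMem`): `h₀² = 2·X₀²X₁X₂² + (X₁²X₀ + 2X₁⁴)·X₀³ + (X₀²X₁³ + 2X₂²X₀)·X₁³ + X₂·X₂³`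
  (`h0_sq_eq`), the monomial `X₀²X₁X₂²` has all exponents `< 3` (`monomial_notMem_frobeniusSpan`)
  and its coefficient `2` is a unit in characteristic `3`. The clause then moves along
  `S_P/(h₀) ≅ (S/(h₀))_Q` (`QuotLocalizationIso.stub_quotLocalizationIso`,
  `DegreeZeroDescent.inlineClause_of_ringEquiv`).
* If `X₁ ∉ P` (`clause_of_X_one_notMem`), then `∂h₀/∂X₀ = 2X₁X₀ + X₁³ ∉ P` (`pderiv_zero_h0`;
  `2X₁X₀ ∈ P` as `X₀ ∈ P`, while `X₁³ ∉ P` by primality), so `(S/(h₀))_Q` is a regular local ring by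
  the Jacobian criterion (`HypersurfaceRegular.stub_hypersurfaceRegularOfPderiv`, [Matsumura1987]
  Thm. 30.4) and the clause holds for regular local rings of characteristic `3`
  (`FiClauseOfRegular.stub_fiClauseOfRegular`); the characteristic passes to `S/(h₀)` (a non-trivial
  `k`-algebra) and to its localizations (`DegreeZeroDescent.charP_localization_atPrime`).

References: [Fedder1983] R. Fedder, F-purity and rational singularity, Trans. AMS 278 (1983),
Prop. 1.7 and Thm. 1.12; M. Artin, Coverings of the rational double points in characteristic `p`
(1977) for the forms `E₈⁰`, `E₇⁰` (folklore); [Matsumura1987] H. Matsumura, Commutative Ring Theory,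
Thm. 30.4.
-/

-- single-problem summit: the doubled namespace component is forced
set_option linter.dupNamespace false

noncomputable section

namespace Summit.ResolutionOfSingularities.ResolutionOfSingularities.Theorems.FInjectiveMacaulayfication.E7ChartX0Points

open MvPolynomial
open Summit.ResolutionOfSingularities.ResolutionOfSingularities.Theorems.FInjectiveMacaulayfication

/-! ## Polynomial identities for `h₀ = X₂² + X₁X₀² + X₀X₁³` -/

/-- **`∂h₀/∂X₀ = 2X₁X₀ + X₁³`** for `h₀ = X₂² + X₁X₀² + X₀X₁³`, over any commutative ring
(`MvPolynomial.pderiv_mul`, `pderiv_pow`, `pderiv_X_self`, `pderiv_X_of_ne`). [folklore] -/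
theorem pderiv_zero_h0 {A : Type*} [CommRing A] :
    pderiv 0 (X 2 ^ 2 + X 1 * X 0 ^ 2 + X 0 * X 1 ^ 3 : MvPolynomial (Fin 3) A) =
      2 * X 1 * X 0 + X 1 ^ 3 := by
  simp only [map_add, pderiv_mul, pderiv_pow, pderiv_X_self,
    pderiv_X_of_ne (show (2 : Fin 3) ≠ 0 by decide), pderiv_X_of_ne (show (1 : Fin 3) ≠ 0 by decide),
    mul_zero, zero_add, add_zero, mul_one, one_mul, zero_mul]
  push_cast
  ring

/-- **Fedder's cofactors for `h₀ = X₂² + X₁X₀² + X₀X₁³` at exponent `2 = 3 - 1`:**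
`h₀² = 2·X₀²X₁X₂² + (X₁²X₀ + 2X₁⁴)·X₀³ + (X₀²X₁³ + 2X₂²X₀)·X₁³ + X₂·X₂³` over any commutative ring
(a polynomial identity, `ring`). [folklore] -/
theorem h0_sq_eq {A : Type*} [CommRing A] :
    (X 2 ^ 2 + X 1 * X 0 ^ 2 + X 0 * X 1 ^ 3 : MvPolynomial (Fin 3) A) ^ 2 =
      2 * (X 0 ^ 2 * X 1 ^ 1 * X 2 ^ 2) +
        ((X 1 ^ 2 * X 0 + 2 * X 1 ^ 4) * X 0 ^ 3 + (X 0 ^ 2 * X 1 ^ 3 + 2 * X 2 ^ 2 * X 0) * X 1 ^ 3 +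
          X 2 * X 2 ^ 3) := by
  ring

/-- The monomial `X₀²X₁X₂²` is not in the monomial ideal `(X₀³, X₁³, X₂³)` (no exponent reaches `3`;
`MvPolynomial.mem_ideal_span_monomial_image`). [folklore] -/
theorem monomial_notMem_frobeniusSpan (k : Type) [Field k] :
    (X 0 ^ 2 * X 1 ^ 1 * X 2 ^ 2 : MvPolynomial (Fin 3) k) ∉
      Ideal.span (Set.range fun i : Fin 3 => (X i : MvPolynomial (Fin 3) k) ^ 3) := by
  classical
  have hrange : (Set.range fun i : Fin 3 => (X i : MvPolynomial (Fin 3) k) ^ 3) =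
      (fun s => monomial s (1 : k)) '' Set.range (fun i : Fin 3 => Finsupp.single i 3) := by
    rw [← Set.range_comp]
    refine congrArg Set.range (funext fun i => ?_)
    simp only [Function.comp_apply, X_pow_eq_monomial]
  have hmon : (X 0 ^ 2 * X 1 ^ 1 * X 2 ^ 2 : MvPolynomial (Fin 3) k) =
      monomial (Finsupp.single 0 2 + Finsupp.single 1 1 + Finsupp.single 2 2) 1 := by
    simp only [X_pow_eq_monomial, monomial_mul, mul_one]
  rw [hrange, hmon, mem_ideal_span_monomial_image]
  intro h
  obtain ⟨si, hsi, hle⟩ := h _ (by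
    rw [support_monomial, if_neg one_ne_zero]
    exact Finset.mem_singleton_self _)
  obtain ⟨i, rfl⟩ := hsi
  have h3 := Finsupp.single_le_iff.mp hle
  fin_cases i <;> simp at h3

/-- **Fedder's test passes for `h₀` in characteristic `3`**: `h₀² ∉ (X₀³, X₁³, X₂³) = 𝔪^[3]` for
`h₀ = X₂² + X₁X₀² + X₀X₁³` over a field of characteristic `3`: modulo `(Xᵢ³)`, `h₀² ≡ 2·X₀²X₁X₂²`
(`h0_sq_eq`), the coefficient `2` is a unit, and `X₀²X₁X₂² ∉ (Xᵢ³)` (`monomial_notMem_frobeniusSpan`).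
[cite: Fedder1983, Prop. 1.7] -/
theorem h0_sq_notMem (k : Type) [Field k] [CharP k 3] :
    (X 2 ^ 2 + X 1 * X 0 ^ 2 + X 0 * X 1 ^ 3 : MvPolynomial (Fin 3) k) ^ 2 ∉
      Ideal.span (Set.range fun i : Fin 3 => (X i : MvPolynomial (Fin 3) k) ^ 3) := by
  set I : Ideal (MvPolynomial (Fin 3) k) :=
    Ideal.span (Set.range fun i : Fin 3 => (X i : MvPolynomial (Fin 3) k) ^ 3) with hI
  intro h
  have hXI : ∀ i : Fin 3, (X i : MvPolynomial (Fin 3) k) ^ 3 ∈ I := fun i => Ideal.subset_span ⟨i, rfl⟩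
  -- the cofactor part lies in `I`
  have hq : ((X 1 ^ 2 * X 0 + 2 * X 1 ^ 4) * X 0 ^ 3 + (X 0 ^ 2 * X 1 ^ 3 + 2 * X 2 ^ 2 * X 0) * X 1 ^ 3 +
      X 2 * X 2 ^ 3 : MvPolynomial (Fin 3) k) ∈ I :=
    add_mem (add_mem (Ideal.mul_mem_left _ _ (hXI 0)) (Ideal.mul_mem_left _ _ (hXI 1)))
      (Ideal.mul_mem_left _ _ (hXI 2))
  -- hence `2 · X₀²X₁X₂² ∈ I`
  have h2 : (2 * (X 0 ^ 2 * X 1 ^ 1 * X 2 ^ 2) : MvPolynomial (Fin 3) k) ∈ I := by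
    have h' := sub_mem h hq
    rwa [h0_sq_eq, add_sub_cancel_right] at h'
  -- `2` is a unit in characteristic `3`
  have hunit : (2 : k) ≠ 0 := by
    intro h0
    have h1 : ((2 : ℕ) : k) = 0 := by exact_mod_cast h0
    rw [CharP.cast_eq_zero_iff k 3] at h1
    omega
  have hm : (X 0 ^ 2 * X 1 ^ 1 * X 2 ^ 2 : MvPolynomial (Fin 3) k) ∈ I := by
    have h' := Ideal.mul_mem_left I (C (2 : k)⁻¹) h2
    have hC : (2 : MvPolynomial (Fin 3) k) = C (2 : k) := by
      rw [map_ofNat]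
    rwa [hC, ← mul_assoc, ← map_mul, inv_mul_cancel₀ hunit, map_one, one_mul] at h'
  exact monomial_notMem_frobeniusSpan k hm

/-- The form `h₀ = X₂² + X₁X₀² + X₀X₁³` lies in `(X₀, X₁, X₂)` and is non-zero (it takes the value `1`
at `(0, 0, 1)`). [folklore] -/
theorem h0_mem_and_ne_zero (k : Type) [Field k] :
    (X 2 ^ 2 + X 1 * X 0 ^ 2 + X 0 * X 1 ^ 3 : MvPolynomial (Fin 3) k) ∈
        Ideal.span (Set.range (X : Fin 3 → MvPolynomial (Fin 3) k)) ∧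
      (X 2 ^ 2 + X 1 * X 0 ^ 2 + X 0 * X 1 ^ 3 : MvPolynomial (Fin 3) k) ≠ 0 := by
  have hX : ∀ i : Fin 3, (X i : MvPolynomial (Fin 3) k) ∈
      Ideal.span (Set.range (X : Fin 3 → MvPolynomial (Fin 3) k)) :=
    fun i => Ideal.subset_span ⟨i, rfl⟩
  refine ⟨?_, ?_⟩
  · exact add_mem (add_mem (Ideal.pow_mem_of_mem _ (hX 2) 2 (by norm_num))
      (Ideal.mul_mem_right _ _ (hX 1))) (Ideal.mul_mem_right _ _ (hX 0))
  · intro h0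
    have h1 := congrArg (MvPolynomial.aeval (fun i : Fin 3 => (![0, 0, 1] : Fin 3 → k) i)) h0
    simp [Matrix.cons_val_zero, Matrix.cons_val_one, Matrix.cons_val] at h1

/-! ## The two kinds of points of the `X₀`-chart on the exceptional divisor -/

/-- **The `D`-type point at the origin.** For a field `k` of characteristic `3`,
`h₀ = X₂² + X₁X₀² + X₀X₁³`, the origin `P = (X₀, X₁, X₂)` of `S = k[X₀, X₁, X₂]` and a prime `Q` of
`S/(h₀)` with `Q ∩ S = P`, the local ring `(S/(h₀))_Q` satisfies the per-stalk clause (inline form,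
`p = 3`): Fedder's test at the origin (`Fedder.fedder_criterion_origin` with `h0_sq_notMem`) gives it for
`S_P/(h₀)`, and it is transported along `S_P/(h₀) ≅ (S/(h₀))_Q`
(`QuotLocalizationIso.stub_quotLocalizationIso`, `DegreeZeroDescent.inlineClause_of_ringEquiv`).
[cite: Fedder1983, Prop. 1.7 and Thm. 1.12] -/
theorem clause_of_comap_eq_origin (k : Type) [Field k] [CharP k 3] (h0 : MvPolynomial (Fin 3) k)
    (hh0 : h0 = X 2 ^ 2 + X 1 * X 0 ^ 2 + X 0 * X 1 ^ 3)
    (P : Ideal (MvPolynomial (Fin 3) k)) [P.IsMaximal]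
    (hP : P = Ideal.span (Set.range (X : Fin 3 → MvPolynomial (Fin 3) k)))
    (Q : Ideal (MvPolynomial (Fin 3) k ⧸ Ideal.span {h0})) [Q.IsPrime]
    (hQP : Q.comap (Ideal.Quotient.mk (Ideal.span {h0})) = P) :
    ∀ d : ℕ, ringKrullDim (Localization.AtPrime Q) = d → ∀ s : Fin d → Localization.AtPrime Q,
      (Ideal.span (Set.range s)).radical.IsMaximal →
        RingTheory.Sequence.IsWeaklyRegular (Localization.AtPrime Q) (List.ofFn s) ∧
        ∀ y : Localization.AtPrime Q, (∃ e : ℕ, y ^ 3 ^ e ∈ Ideal.span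
          ((fun z : Localization.AtPrime Q => z ^ 3 ^ e) ''
            (Ideal.span (Set.range s) : Set (Localization.AtPrime Q)))) → y ∈ Ideal.span (Set.range s) := by
  haveI : Fact (Nat.Prime 3) := ⟨Nat.prime_three⟩
  obtain ⟨hgP, hg0⟩ : h0 ∈ P ∧ h0 ≠ 0 := by
    rw [hh0, hP]
    exact h0_mem_and_ne_zero k
  have hL := (Fedder.fedder_criterion_origin 3 k 3 P hP h0 hgP hg0).mpr (by
    rw [hh0]
    exact h0_sq_notMem k)
  obtain ⟨e⟩ := QuotLocalizationIso.stub_quotLocalizationIso (MvPolynomial (Fin 3) k) h0 P Q hQP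
  exact DegreeZeroDescent.inlineClause_of_ringEquiv 3 e hL

/-- **The regular points.** For a field `k` of characteristic `3`, `h₀ = X₂² + X₁X₀² + X₀X₁³` and a
maximal ideal `Q` of `S/(h₀)` with `X̄₀ ∈ Q` but `X₁ ∉ P = Q ∩ S`, the local ring `(S/(h₀))_Q` satisfies
the per-stalk clause (inline form, `p = 3`): `∂h₀/∂X₀ = 2X₁X₀ + X₁³ ∉ P` (else `X₁³ ∈ P`, `X₁ ∈ P`), so
`(S/(h₀))_Q` is a regular local ring (`HypersurfaceRegular.stub_hypersurfaceRegularOfPderiv`) of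
characteristic `3`, and regular local rings satisfy the clause (`FiClauseOfRegular.stub_fiClauseOfRegular`).
[cite: Matsumura1987, Thm. 30.4 (ii)] -/
theorem clause_of_X_one_notMem (k : Type) [Field k] [CharP k 3] (h0 : MvPolynomial (Fin 3) k)
    (hh0 : h0 = X 2 ^ 2 + X 1 * X 0 ^ 2 + X 0 * X 1 ^ 3)
    (Q : Ideal (MvPolynomial (Fin 3) k ⧸ Ideal.span {h0})) [Q.IsMaximal]
    (hX0 : Ideal.Quotient.mk (Ideal.span {h0}) (X 0) ∈ Q)
    (hX1 : (X 1 : MvPolynomial (Fin 3) k) ∉ Q.comap (Ideal.Quotient.mk (Ideal.span {h0}))) :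
    ∀ d : ℕ, ringKrullDim (Localization.AtPrime Q) = d → ∀ s : Fin d → Localization.AtPrime Q,
      (Ideal.span (Set.range s)).radical.IsMaximal →
        RingTheory.Sequence.IsWeaklyRegular (Localization.AtPrime Q) (List.ofFn s) ∧
        ∀ y : Localization.AtPrime Q, (∃ e : ℕ, y ^ 3 ^ e ∈ Ideal.span
          ((fun z : Localization.AtPrime Q => z ^ 3 ^ e) ''
            (Ideal.span (Set.range s) : Set (Localization.AtPrime Q)))) → y ∈ Ideal.span (Set.range s) := by
  haveI : Fact (Nat.Prime 3) := ⟨Nat.prime_three⟩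
  -- the Jacobian direction `∂/∂X₀` is regular at `Q`
  have hd : pderiv 0 h0 ∉ Q.comap (Ideal.Quotient.mk (Ideal.span {h0})) := by
    intro hmem
    have hpd : pderiv 0 h0 = 2 * X 1 * X 0 + X 1 ^ 3 := by
      rw [hh0]
      exact pderiv_zero_h0
    rw [hpd] at hmem
    have hX0' : (X 0 : MvPolynomial (Fin 3) k) ∈ Q.comap (Ideal.Quotient.mk (Ideal.span {h0})) := hX0
    have h2 : (2 * X 1 * X 0 : MvPolynomial (Fin 3) k) ∈ Q.comap (Ideal.Quotient.mk (Ideal.span {h0})) :=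
      Ideal.mul_mem_left _ _ hX0'
    have hX13 : (X 1 : MvPolynomial (Fin 3) k) ^ 3 ∈ Q.comap (Ideal.Quotient.mk (Ideal.span {h0})) := by
      have h' := sub_mem hmem h2
      rwa [add_sub_cancel_left] at h'
    exact hX1 (Ideal.IsPrime.mem_of_pow_mem inferInstance 3 hX13)
  haveI : IsRegularLocalRing (Localization.AtPrime Q) :=
    HypersurfaceRegular.stub_hypersurfaceRegularOfPderiv k 3 h0 0 Q hd
  -- characteristic `3` passes to `S/(h₀)` (a non-trivial `k`-algebra) and to its localization
  haveI : Nontrivial (MvPolynomial (Fin 3) k ⧸ Ideal.span {h0}) :=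
    nontrivial_of_ne (1 : MvPolynomial (Fin 3) k ⧸ Ideal.span {h0}) 0 fun h10 =>
      Ideal.IsMaximal.ne_top ‹_› ((Ideal.eq_top_iff_one Q).mpr (by rw [h10]; exact Q.zero_mem))
  haveI : CharP (MvPolynomial (Fin 3) k ⧸ Ideal.span {h0}) 3 :=
    charP_of_injective_algebraMap
      (algebraMap k (MvPolynomial (Fin 3) k ⧸ Ideal.span {h0})).injective 3
  haveI : CharP (Localization.AtPrime Q) 3 := DegreeZeroDescent.charP_localization_atPrime 3 Q
  exact (FiClauseOfRegular.stub_fiClauseOfRegular 3 (Localization.AtPrime Q)).2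

/-! ## Registered form -/

/-- **CALIBRATION, `X₀`-chart of the second step of the characteristic-3 tower over `E₈⁰`** (stub
`stub_e7ChartX0Points` of line `Sketch`): for a field `k` of characteristic `3` and
`h₀ = X₂² + X₁X₀² + X₀X₁³ ∈ S = k[X₀, X₁, X₂]` (the strict transform of the `E₇⁰`-type form
`X₂² + X₁X₀³ + X₁³` on the `X₀`-chart of the blow-up of the origin), the local ring of the hypersurface
`S/(h₀)` at every maximal ideal `Q` on the exceptional divisor (`X̄₀ ∈ Q`) satisfies the per-stalk clause
of `FrobeniusLadder.FInjectiveMacaulayfication`: every system of parameters is weakly regular and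
generates a Frobenius closed ideal. Two cases on `P = Q ∩ S`: `X₁ ∈ P` forces `P = (X₀, X₁, X₂)`, the
`D`-type point, certified by Fedder's test (`clause_of_comap_eq_origin`); `X₁ ∉ P` is a regular point by
the Jacobian criterion (`clause_of_X_one_notMem`). [cite: Fedder1983, Prop. 1.7 and Thm. 1.12] -/
theorem stub_e7ChartX0Points : ∀ (k : Type) [Field k] [CharP k 3] (h0 : MvPolynomial (Fin 3) k),
    h0 = MvPolynomial.X 2 ^ 2 + MvPolynomial.X 1 * MvPolynomial.X 0 ^ 2 + MvPolynomial.X 0 * MvPolynomial.X 1 ^ 3 →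
    ∀ (Q : Ideal (MvPolynomial (Fin 3) k ⧸ Ideal.span {h0})) [Q.IsMaximal],
      Ideal.Quotient.mk (Ideal.span {h0}) (MvPolynomial.X 0) ∈ Q →
      ∀ d : ℕ, ringKrullDim (Localization.AtPrime Q) = d → ∀ s : Fin d → Localization.AtPrime Q,
        (Ideal.span (Set.range s)).radical.IsMaximal →
          RingTheory.Sequence.IsWeaklyRegular (Localization.AtPrime Q) (List.ofFn s) ∧
          ∀ y : Localization.AtPrime Q, (∃ e : ℕ, y ^ 3 ^ e ∈ Ideal.span
            ((fun z : Localization.AtPrime Q => z ^ 3 ^ e) ''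
              (Ideal.span (Set.range s) : Set (Localization.AtPrime Q)))) → y ∈ Ideal.span (Set.range s) := by
  intro k _ _ h0 hh0 Q _ hX0
  by_cases hX1 : (X 1 : MvPolynomial (Fin 3) k) ∈ Q.comap (Ideal.Quotient.mk (Ideal.span {h0}))
  · -- the `D`-type point: `P = Q ∩ S` contains `X₀`, `X₁` and `X₂² = h₀ - X₀ (X₁X₀ + X₁³)`, so it is the origin
    have hX0' : (X 0 : MvPolynomial (Fin 3) k) ∈ Q.comap (Ideal.Quotient.mk (Ideal.span {h0})) := hX0
    have hgP : h0 ∈ Q.comap (Ideal.Quotient.mk (Ideal.span {h0})) := by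
      rw [Ideal.mem_comap, Ideal.Quotient.eq_zero_iff_mem.mpr (Ideal.mem_span_singleton_self h0)]
      exact Q.zero_mem
    have hX2sq : (X 2 : MvPolynomial (Fin 3) k) ^ 2 ∈ Q.comap (Ideal.Quotient.mk (Ideal.span {h0})) := by
      have h : (X 2 : MvPolynomial (Fin 3) k) ^ 2 = h0 - X 0 * (X 1 * X 0 + X 1 ^ 3) := by
        rw [hh0]
        ring
      rw [h]
      exact sub_mem hgP (Ideal.mul_mem_right _ _ hX0')
    have hX2 : (X 2 : MvPolynomial (Fin 3) k) ∈ Q.comap (Ideal.Quotient.mk (Ideal.span {h0})) :=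
      Ideal.IsPrime.mem_of_pow_mem inferInstance 2 hX2sq
    have hPeq := E8ChartYPoints.eq_span_range_X_of_mem k (Q.comap (Ideal.Quotient.mk (Ideal.span {h0})))
      hX0' hX1 hX2
    haveI := Fedder.isMaximal_span_range_X k 3
    exact clause_of_comap_eq_origin k h0 hh0 (Ideal.span (Set.range X)) rfl Q hPeq
  · -- a regular point of the chart
    exact clause_of_X_one_notMem k h0 hh0 Q hX0 hX1

end Summit.ResolutionOfSingularities.ResolutionOfSingularities.Theorems.FInjectiveMacaulayfication.E7ChartX0Points

end
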